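import Mathlib.RingTheory.Localization.AtPrime.Basic
import Mathlib.RingTheory.Localization.Basic
import Literature.RingTheory.CompleteIntersection.CongruenceModule
import HarnessLib

/-!
# The congruence ideal after localising at the maximal ideal of the augmentation

Let `O` be a *local* commutative ring, `T` a commutative `O`-algebra and `π : T →ₐ[O] O` an
augmentation with congruence ideal `η_T = π(Ann_T(ker π))`
(`Literature.RingTheory.CompleteIntersection.congruenceIdeal`). The ideal
`𝔪 = π⁻¹(𝔪_O) ⊇ ker π` (`comapMaximalIdeal π`) is maximal, `π` inverts `T ∖ 𝔪`, and so `π`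
extends uniquely to an augmentation `π_𝔪 : T_𝔪 →ₐ[O] O` of the localisation
(`localizedAugmentation π S`, for any `IsLocalization.AtPrime S 𝔪`). This is how the Hecke
algebras of the deformation-theoretic literature arise: Darmon–Diamond–Taylor, *Fermat's Last
Theorem*, §4.1–4.2 (the full Hecke algebra `𝕋_O`, its maximal ideal `𝔪` attached to an
eigenform, `𝕋_𝔪`, and Prop. 4.7: `𝕋_Σ ≅ 𝕋_𝔪`), with the congruence ideal `η_Σ` of (3.3.1) taken
on `𝕋_Σ`; Diamond–Ribet (CSS 1997, p. 362 and p. 364) likewise.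

Main results:

* `congruenceIdeal_le_congruenceIdeal_localizedAugmentation`: `η_T ⊆ η_{T_𝔪}` always;
* `congruenceIdeal_localizedAugmentation_eq`: `η_{T_𝔪} = η_T` as soon as `ker π` is finitely
  generated (e.g. `T` Noetherian, in particular `T` module-finite over a Noetherian `O` — the
  case of Hecke algebras), because annihilators of finitely generated ideals localise. So the
  congruence ideal may be computed before or after localising at `𝔪`.

## References

* H. Darmon, F. Diamond, R. Taylor, *Fermat's Last Theorem*, Current Developments in Math.
  1995, (3.3.1), §4.1 (pp. 106–109), Prop. 4.7. [DarmonDiamondTaylor1995]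
* F. Diamond, K. A. Ribet, *ℓ-adic modular deformations and Wiles's "Main Conjecture"*, in:
  Modular Forms and Fermat's Last Theorem, Springer 1997, pp. 362–364. [DiamondRibet1997]
-/

namespace Literature.RingTheory.CompleteIntersection

variable {O : Type*} [CommRing O] [IsLocalRing O]
variable {T : Type*} [CommRing T] [Algebra O T] (π : T →ₐ[O] O)

/-! ### The maximal ideal `𝔪 = π⁻¹(𝔪_O)` -/

/-- The maximal ideal `𝔪 = π⁻¹(𝔪_O)` of `T` attached to the augmentation `π` over a local `O`:
the kernel of `T → O → O/𝔪_O` (for a Hecke algebra and the augmentation of an eigenform `f`,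
the maximal ideal of the residual eigensystem `f̄`, Darmon–Diamond–Taylor §4.1, p. 108).
[cite: DarmonDiamondTaylor1995, §4.1, p. 108] -/
def comapMaximalIdeal : Ideal T :=
  (IsLocalRing.maximalIdeal O).comap π

/-- `t ∈ 𝔪 ↔ π t ∈ 𝔪_O`. [folklore] -/
theorem mem_comapMaximalIdeal_iff {t : T} :
    t ∈ comapMaximalIdeal π ↔ π t ∈ IsLocalRing.maximalIdeal O :=
  Ideal.mem_comap

/-- `𝔪 = π⁻¹(𝔪_O)` is a maximal ideal (`π` is surjective). [folklore] -/
instance comapMaximalIdeal.isMaximal : (comapMaximalIdeal π).IsMaximal :=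
  Ideal.comap_isMaximal_of_surjective π (augmentation_surjective π)

/-- `ker π ⊆ 𝔪`. [folklore] -/
theorem ker_le_comapMaximalIdeal : RingHom.ker π ≤ comapMaximalIdeal π := by
  intro t ht
  rw [mem_comapMaximalIdeal_iff, RingHom.mem_ker.mp ht]
  exact zero_mem _

/-- `𝔪` is the kernel of the residual augmentation `T → O → O/𝔪_O`. [folklore] -/
theorem comapMaximalIdeal_eq_ker_residue :
    comapMaximalIdeal π = RingHom.ker ((IsLocalRing.residue O).comp (π : T →+* O)) := by
  ext t
  rw [mem_comapMaximalIdeal_iff, RingHom.mem_ker, RingHom.comp_apply,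
    IsLocalRing.residue_eq_zero_iff]
  rfl

/-- `π` inverts the complement of `𝔪`: `π t` is a unit for `t ∉ 𝔪`. [folklore] -/
theorem isUnit_apply_of_not_mem {t : T} (ht : t ∉ comapMaximalIdeal π) : IsUnit (π t) :=
  IsLocalRing.notMem_maximalIdeal.mp ht

/-! ### The localised augmentation `π_𝔪 : T_𝔪 → O` -/

section Localized

variable (S : Type*) [CommRing S] [Algebra T S] [Algebra O S] [IsScalarTower O T S]
  [IsLocalization.AtPrime S (comapMaximalIdeal π)]

/-- The **localised augmentation** `π_𝔪 : T_𝔪 →ₐ[O] O`, the unique extension of `π` to the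
localisation of `T` at `𝔪 = π⁻¹(𝔪_O)` (it exists because `π(T ∖ 𝔪) ⊆ Oˣ`); for Hecke
algebras this is the map `π : 𝕋_Σ ≅ 𝕋_𝔪 → O` of Darmon–Diamond–Taylor §3.3 / Prop. 4.7 whose
congruence ideal is `η_Σ` ((3.3.1)). [cite: DarmonDiamondTaylor1995, §3.3 (3.3.1) and Prop. 4.7] -/
noncomputable def localizedAugmentation : S →ₐ[O] O :=
  IsLocalization.liftAlgHom (M := (comapMaximalIdeal π).primeCompl) (f := π)
    fun y => isUnit_apply_of_not_mem π y.2

/-- `π_𝔪` extends `π`. [folklore] -/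
@[simp] theorem localizedAugmentation_algebraMap (t : T) :
    localizedAugmentation π S (algebraMap T S t) = π t := by
  rw [localizedAugmentation, IsLocalization.liftAlgHom_apply, IsLocalization.lift_eq]
  rfl

/-- `π_𝔪 (t/s) · π s = π t`. [folklore] -/
theorem localizedAugmentation_mk'_mul (t : T) (s : (comapMaximalIdeal π).primeCompl) :
    localizedAugmentation π S (IsLocalization.mk' S t s) * π s = π t := by
  rw [mul_comm, eq_comm]
  exact (IsLocalization.lift_mk'_spec (fun y => isUnit_apply_of_not_mem π y.2) t _ s).mp rfl

/-- `π_𝔪 (t/s) = 0 ↔ π t = 0`. [folklore] -/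
theorem localizedAugmentation_mk'_eq_zero_iff (t : T) (s : (comapMaximalIdeal π).primeCompl) :
    localizedAugmentation π S (IsLocalization.mk' S t s) = 0 ↔ π t = 0 := by
  constructor
  · intro h
    rw [← localizedAugmentation_mk'_mul π S t s, h, zero_mul]
  · intro h
    have hu := isUnit_apply_of_not_mem π s.2
    have h2 := localizedAugmentation_mk'_mul π S t s
    rw [h] at h2
    exact (hu.mul_left_eq_zero).mp h2

/-- **`η_T ⊆ η_{T_𝔪}`**: the congruence ideal can only grow under localisation at `𝔪` (the
image of `Ann_T(ker π)` annihilates `ker π_𝔪 = (ker π) T_𝔪`). [folklore] -/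
theorem congruenceIdeal_le_congruenceIdeal_localizedAugmentation :
    congruenceIdeal π ≤ congruenceIdeal (localizedAugmentation π S) := by
  intro x hx
  obtain ⟨t, ht, rfl⟩ := (mem_congruenceIdeal_iff π).mp hx
  rw [← localizedAugmentation_algebraMap π S t]
  refine apply_mem_congruenceIdeal _ ((mem_annihilator_ker_iff _).mpr fun y hy => ?_)
  obtain ⟨a, s, rfl⟩ := IsLocalization.exists_mk'_eq (comapMaximalIdeal π).primeCompl y
  rw [localizedAugmentation_mk'_eq_zero_iff] at hy
  rw [← Algebra.smul_def, IsLocalization.smul_mk', (mem_annihilator_ker_iff π).mp ht a hy,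
    IsLocalization.mk'_zero]

/-- **`η_{T_𝔪} = η_T` when `ker π` is finitely generated** (e.g. `T` Noetherian): the congruence
ideal of Darmon–Diamond–Taylor (3.3.1) / Diamond–Ribet p. 364, defined on the local algebra
`𝕋_Σ ≅ 𝕋_𝔪`, agrees with the one computed on the full Hecke algebra `𝕋_O`. Proof: for
`y = a/s ∈ Ann_{T_𝔪}(ker π_𝔪)` and generators `g_i` of `ker π`, `a g_i / s = 0` gives
`u_i a g_i = 0` with `u_i ∉ 𝔪`; with `u = ∏ u_i`, `u a ∈ Ann_T(ker π)` and
`π_𝔪(y) = π(u a) (π u π s)⁻¹ ∈ η_T`. [cite: DarmonDiamondTaylor1995, (3.3.1) with Prop. 4.7] -/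
theorem congruenceIdeal_localizedAugmentation_eq (hfg : (RingHom.ker π).FG) :
    congruenceIdeal (localizedAugmentation π S) = congruenceIdeal π := by
  classical
  refine le_antisymm ?_ (congruenceIdeal_le_congruenceIdeal_localizedAugmentation π S)
  intro x hx
  obtain ⟨y, hy, rfl⟩ := (mem_congruenceIdeal_iff _).mp hx
  obtain ⟨a, s, rfl⟩ := IsLocalization.exists_mk'_eq (comapMaximalIdeal π).primeCompl y
  obtain ⟨G, hG⟩ := hfg
  -- each generator is killed by `a` after multiplying by some `u_g ∉ 𝔪`
  have hgen : ∀ g ∈ G, ∃ u : (comapMaximalIdeal π).primeCompl, (u : T) * (g * a) = 0 := by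
    intro g hg
    have hgker : g ∈ RingHom.ker π := hG ▸ Ideal.subset_span hg
    have h0 : localizedAugmentation π S (algebraMap T S g) = 0 := by
      rw [localizedAugmentation_algebraMap]
      exact hgker
    have h1 := (mem_annihilator_ker_iff _).mp hy (algebraMap T S g) h0
    rw [mul_comm, ← Algebra.smul_def, IsLocalization.smul_mk', IsLocalization.mk'_eq_zero_iff]
      at h1
    exact h1
  choose! u hu using hgen
  set U : (comapMaximalIdeal π).primeCompl := ∏ g ∈ G, u g with hU
  have hUa : (U : T) * a ∈ (RingHom.ker π).annihilator := by
    rw [← hG, Submodule.mem_annihilator_span]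
    rintro ⟨g, hg⟩
    rw [smul_eq_mul, hU, ← Finset.mul_prod_erase G u hg, Submonoid.coe_mul,
      Submonoid.coe_finsetProd]
    calc ((u g : T) * ∏ x ∈ G.erase g, (u x : T)) * a * g
        = (∏ x ∈ G.erase g, (u x : T)) * ((u g : T) * (g * a)) := by ring
      _ = 0 := by rw [hu g hg, mul_zero]
  -- `π_𝔪 (a/s) = π (U a) · (π U)⁻¹ (π s)⁻¹`
  have hmem : π ((U : T) * a) ∈ congruenceIdeal π := apply_mem_congruenceIdeal π hUa
  obtain ⟨w, hw⟩ := (isUnit_apply_of_not_mem π U.2).mul (isUnit_apply_of_not_mem π s.2)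
  have key : (w : O) * localizedAugmentation π S (IsLocalization.mk' S a s) = π ((U : T) * a) := by
    rw [hw, map_mul, mul_assoc, mul_comm (π (s : T)), localizedAugmentation_mk'_mul]
  have : localizedAugmentation π S (IsLocalization.mk' S a s) =
      (w⁻¹ : Oˣ) * π ((U : T) * a) := by
    rw [← key, Units.inv_mul_cancel_left]
  rw [this]
  exact Ideal.mul_mem_left _ _ hmem

/-- In particular for Noetherian `T`. [cite: DarmonDiamondTaylor1995, (3.3.1) with Prop. 4.7] -/
theorem congruenceIdeal_localizedAugmentation_eq_of_isNoetherianRing [IsNoetherianRing T] :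
    congruenceIdeal (localizedAugmentation π S) = congruenceIdeal π :=
  congruenceIdeal_localizedAugmentation_eq π S (IsNoetherian.noetherian _)

end Localized

end Literature.RingTheory.CompleteIntersection
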